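import Literature.IUT.LogVolume.Corollary23Chain
import Literature.IUT.LogVolume.Corollary23JInv
import Literature.NumberTheory.DiophantineGeometry.GenEllThm21PrimesHolds
import HarnessLib

/-!
# [IUTchIV] Cor 2.2 ⟹ Cor 2.3 ⟹ abc for `(ℙ¹_ℚ, {0,1,∞})`: the campaign-S chain with its classical inputs
# DISCHARGED

S. Mochizuki, *Inter-universal Teichmüller theory IV*, Cor. 2.2–2.3 pp. 41–55
[claim: Mochizuki2012, status: disputed] (only the shape of the printed reduction "Cor. 2.3 follows from
Cor. 2.2 and [GenEll] Thm. 2.1" is used); S. Mochizuki, *Arithmetic elliptic curves in general position*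
(2010), Thm. 2.1 [cite: MochizukiGenEll2010, Thm 2.1 p.11].

`Corollary23Chain.lean` (abc-iut-S3 / abc-iut-L1-d10) proves the declarations of record
`Cor22.vojtaP1Deg_of_corollary22_primes` / `Cor22.abc_of_corollary22_primes` from THREE hypotheses: the
typed [IUTchIV] Cor. 2.2 (`Corollary22 H_unif`, downstream of the disputed [IUTchIII] Cor. 3.12 — never
asserted), the WLOG vacuity sentence `JInvVacuous`, and the named fact `GenEll.GenEll_thm21_primes`
([GenEll] Thm. 2.1 (ii) ⟹ (i)|_{ℙ¹} for finite sets of primes).  The last two are now tree THEOREMS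
(`Cor22.jInvVacuous_holds`, abc-iut-L6-d3 lineage; `GenEll.GenEll_thm21_primes_holds`, abc-iut-S4 W-Σ),
so the chain reads, in the kernel and with no classical hypothesis left:

* `Cor22.vojtaP1Deg_of_corollary22_unconditional` — `Corollary22 H_unif → ∀ d ≥ 1, VojtaP1Deg d`
  ([IUTchIV] Cor. 2.3 for `ℙ¹ ∖ {0,1,∞}` from Cor. 2.2);
* `Cor22.abc_of_corollary22_unconditional` — `Corollary22 H_unif →` the abc sentence for coprime triples.

HONEST FRAMING: nothing disputed is asserted; `Corollary22 H_unif` stays a HYPOTHESIS (the one input of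
the disputed chain).  Theorems only.
-/

noncomputable section

namespace Literature.IUT.LogVolume

namespace Cor22

open Literature.NumberTheory.DiophantineGeometry Literature.NumberTheory.DiophantineGeometry.GenEll

/-- **[IUTchIV] Corollary 2.3 for `(ℙ¹_ℚ, {0,1,∞})`, every degree `d`, from Corollary 2.2 ALONE**:
`Corollary22 H_unif → ∀ d ≥ 1, VojtaP1Deg d` — the WLOG sentence (`jInvVacuous_holds`) and [GenEll]
Thm. 2.1 (`GenEll_thm21_primes_holds`) being tree theorems. [claim: Mochizuki2012, status: disputed] -/
theorem vojtaP1Deg_of_corollary22_unconditional {Hunif : ℝ} (h22 : Corollary22 Hunif) {d : ℕ}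
    (hd : 0 < d) :
    VojtaP1Deg d :=
  vojtaP1Deg_of_corollary22_primes h22 jInvVacuous_holds GenEll_thm21_primes_holds hd

/-- **The campaign-S endpoint at the level of [IUTchIV] §2, classical inputs discharged**: the abc
sentence for coprime triples from the typed `Corollary22 H_unif` alone.
[claim: Mochizuki2012, status: disputed] -/
theorem abc_of_corollary22_unconditional {Hunif : ℝ} (h22 : Corollary22 Hunif) :
    ∀ ε : ℝ, 0 < ε → ∃ C : ℝ, 0 < C ∧
      ∀ a b c : ℕ, IsABCTriple a b c → (c : ℝ) < C * ((rad a b c : ℕ) : ℝ) ^ (1 + ε) :=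
  abc_of_corollary22_primes h22 jInvVacuous_holds GenEll_thm21_primes_holds

end Cor22

end Literature.IUT.LogVolume

end
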